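/-
Copyright: statement-level skeleton of a published paper (lit-balaban cell, Phase-2 proof seat p19, gen 2). No claims beyond
what the kernel checks below.
-/
import Mathlib

import Mathlib

/-!
# B3 — T. Bałaban, *(Higgs)₂,₃ quantum fields in a finite volume. III. Renormalization*, CMP **88** (1983) 411–445
[Balaban1983Higgs3] — Sect. 2, pp. 426–428: the multiscale cube geometry behind the proof of (2.15)/(2.16)

statement-level skeleton of published theorems with citation tags; proofs where landed; nothing here is a claim about
the Yang–Mills mass gap

PDF held: `paper:balaban1983-higgs-2-3-quantum-fields-finite-volume` (journal page = PDF page + 410); displays read on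
the ×2 renders `pub-balaban/b2b-balaban-ref1/pages/1983-cmp88-higgs23-III/1983-cmp88-higgs23-III-p016, p017,
p018-x2.png` (pp. 426, 427, 428).

WHAT IS REPRODUCED.  Part of the Phase-2 proof of SKELETON rows **B3.Eq2.15-2.16** (unit `lit-balaban-p19` gen 2, HOME `run/shared/lean/pub/lit-balaban/`): files `B3Ineq215CubeGeometry` → `B3Ineq215DecaySum`, `B3Ineq215Quotient` → `B3Ineq215Degrees` → `B3Ineq215Reroute` → `B3Ineq215Step` → `B3Ineq215Proof` (the theorem `Model.ineq215`), all in the sub-namespace `…Balaban1983to89.B3Ineq215`; the rows were typed by r15 in `B3Sect2FirstEstimate`.  The proof of (2.15) p. 427 [PDF 17] sums the weight (2.14) over the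
localization cubes *"Δ(v) of the size L^{j(v)}η"* (p. 426) and over the scale assignments, using four facts about
cubes which the text invokes in words: (a) *"we sum over Δ(v) ⊂ Δ(v₁) using the factor (L^{j(v)}η)^d"* — a cube of side
L^{t′}η contains exactly L^{(t′−t)d} cubes of side L^tη (`card_desc`, `sum_desc_anc`); (b) *"These factors combined with
the exponential factors of the lines l′ give us the factors exp[−δ₂(L^{j_{l′}}η)^{−1}dist(Δ(v), Δ(v″))]"* — the
re-routing of a decay factor through an intermediate cube, i.e. the triangle inequality
dist(A, C) ≤ dist(A, B) + diam B + dist(B, C) (`distI_triangle`); (c) *"we use it to make the summation over Δ(v′). We get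
some constant O(1) depending on δ₁ and n̄ only, because the linear sizes of Δ(v), Δ(v′) are equal to L^jη"* — the
same-scale decay sum Σ_{Δ′} exp[−δ(L^jη)^{−1}dist(Δ, Δ′)] ≤ K(δ, d) (`Cube.sum_exp_distI_le` in the companion
`B3Ineq215DecaySum`, explicit `Kdec δ d = e^δ(2/(1 − e^{−δ/d}))^d`); (d) enlarging a cube decreases its distance to any other cube
(`distI_anc_le`).  CONCRETE MODEL: positions in units of the finest lattice spacing η = L^{−k}; a cube of scale `s` at
`z ∈ ℕ^d` is the box Π_μ [L^s z_μ, L^s(z_μ+1)) (side L^s η-units = L^sη), `distI` = the sup-distance between boxes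
in η-units (an integer), `anc` = the unique coarser cube containing a given one, `desc` = the finer cubes inside.  Everything here is elementary and kernel-checked; nothing of the paper is asserted.
-/


open Finset

namespace Literature.MathematicalPhysics.QuantumFieldTheory.Balaban1983to89.B3Ineq215

/-- A lattice cube of the multiscale family of p. 426 [PDF 16] (*"cubes Δ(v) of the size L^{j(v)}η"*), in units of the
finest spacing η: scale index `s` (side `L^s`) and position `z ∈ ℕ^d` (the box `Π_μ [L^s z_μ, L^s (z_μ + 1))`).
[cite: Balaban1983Higgs3, (2.14) p.426] -/
@[ext]
structure Cube (d : ℕ) where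
  /-- scale index: the side of the cube is `L^s` (η-units) -/
  s : ℕ
  /-- position: the cube is `Π_μ [L^s z_μ, L^s (z_μ + 1))` -/
  z : Fin d → ℕ
  deriving DecidableEq

variable {d : ℕ} (L : ℕ)

namespace Cube

/-- Lower corner coordinate `L^s z_μ` (η-units). [cite: Balaban1983Higgs3, (2.14) p.426] -/
def lo (A : Cube d) (μ : Fin d) : ℕ := L ^ A.s * A.z μ

/-- Upper corner coordinate `L^s (z_μ + 1)` (η-units). [cite: Balaban1983Higgs3, (2.14) p.426] -/
def hi (A : Cube d) (μ : Fin d) : ℕ := L ^ A.s * (A.z μ + 1)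

/-- `hi = lo + side`. [cite: Balaban1983Higgs3, (2.14) p.426] -/
theorem hi_eq (A : Cube d) (μ : Fin d) : A.hi L μ = A.lo L μ + L ^ A.s := by
  unfold hi lo; ring

/-- `lo ≤ hi`. [cite: Balaban1983Higgs3, (2.14) p.426] -/
theorem lo_le_hi (A : Cube d) (μ : Fin d) : A.lo L μ ≤ A.hi L μ := by
  rw [hi_eq]; exact Nat.le_add_right _ _

/-- The gap between two cubes in the coordinate direction `μ` (0 if their projections overlap).
[cite: Balaban1983Higgs3, (2.14) p.427] -/
def gap (A B : Cube d) (μ : Fin d) : ℕ := max (A.lo L μ - B.hi L μ) (B.lo L μ - A.hi L μ)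

/-- `dist(Δ, Δ′)` of (2.14) p. 427 [PDF 17] in η-units: the sup-distance between the two boxes (an integer).
[cite: Balaban1983Higgs3, (2.14) p.427] -/
def distI (A B : Cube d) : ℕ := Finset.univ.sup (gap L A B)

variable {L}

/-- `gap` is symmetric. [cite: Balaban1983Higgs3, (2.14) p.427] -/
theorem gap_comm (A B : Cube d) (μ : Fin d) : gap L A B μ = gap L B A μ := max_comm _ _

/-- `dist` is symmetric. [cite: Balaban1983Higgs3, (2.14) p.427] -/
theorem distI_comm (A B : Cube d) : distI L A B = distI L B A := by
  unfold distI; congr 1; funext μ; exact gap_comm A B μ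

/-- `dist(Δ, Δ) = 0`. [cite: Balaban1983Higgs3, (2.14) p.427] -/
theorem gap_self (A : Cube d) (μ : Fin d) : gap L A A μ = 0 := by
  unfold gap; simp [Nat.sub_eq_zero_of_le (lo_le_hi L A μ)]

/-- `dist(Δ, Δ) = 0`. [cite: Balaban1983Higgs3, (2.14) p.427] -/
theorem distI_self (A : Cube d) : distI L A A = 0 := by
  apply le_antisymm _ (Nat.zero_le _)
  exact Finset.sup_le fun μ _ => (gap_self A μ).le

/-- Each coordinate gap is at most the distance. [cite: Balaban1983Higgs3, (2.14) p.427] -/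
theorem gap_le_distI (A B : Cube d) (μ : Fin d) : gap L A B μ ≤ distI L A B :=
  Finset.le_sup (f := gap L A B) (Finset.mem_univ μ)

/-- `dist ≤ n` iff every coordinate gap is `≤ n`. [cite: Balaban1983Higgs3, (2.14) p.427] -/
theorem distI_le_iff (A B : Cube d) (n : ℕ) : distI L A B ≤ n ↔ ∀ μ, gap L A B μ ≤ n := by
  simp [distI, Finset.sup_le_iff]

/-! ## (b) re-routing: the triangle inequality through an intermediate cube -/

/-- Coordinatewise: `gap(A, C) ≤ gap(A, B) + L^{s_B} + gap(B, C)` (the side of `B` is its diameter in the sup-norm).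
[cite: Balaban1983Higgs3, p.427] -/
theorem gap_triangle (A B C : Cube d) (μ : Fin d) : gap L A C μ ≤ gap L A B μ + L ^ B.s + gap L B C μ := by
  have hA := hi_eq L A μ
  have hB := hi_eq L B μ
  have hC := hi_eq L C μ
  unfold gap
  generalize A.lo L μ = a at *
  generalize A.hi L μ = a' at *
  generalize B.lo L μ = b at *
  generalize B.hi L μ = b' at *
  generalize C.lo L μ = c at *
  generalize C.hi L μ = c' at *
  omega

/-- p. 427 [PDF 17]: *"We represent the exponential factor for the line l(1) as a product of as many equal factors as there
are legs in v′ … These factors combined with the exponential factors of the lines l′ give us the factors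
exp[−δ₂(L^{j_{l′}}η)^{−1}dist(Δ(v), Δ(v″))]"* — the geometric fact used: `dist(A, C) ≤ dist(A, B) + diam(B) + dist(B, C)`
with `diam(B) = L^{s_B}` (η-units). [cite: Balaban1983Higgs3, p.427] -/
theorem distI_triangle (A B C : Cube d) : distI L A C ≤ distI L A B + L ^ B.s + distI L B C := by
  rw [distI_le_iff]
  intro μ
  calc gap L A C μ ≤ gap L A B μ + L ^ B.s + gap L B C μ := gap_triangle A B C μ
    _ ≤ distI L A B + L ^ B.s + distI L B C := by
        gcongr
        · exact gap_le_distI A B μ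
        · exact gap_le_distI B C μ

/-! ## (d) ancestors: the coarser cube containing a given one -/

variable (L) in
/-- The cube of scale `s'` containing `A` (for `A.s ≤ s'`): position `z_μ div L^{s'−s}`.
[cite: Balaban1983Higgs3, p.427] -/
def anc (s' : ℕ) (A : Cube d) : Cube d := ⟨s', fun μ => A.z μ / L ^ (s' - A.s)⟩

/-- The scale of the ancestor. [cite: Balaban1983Higgs3, p.427] -/
@[simp] theorem anc_s (s' : ℕ) (A : Cube d) : (anc L s' A).s = s' := rfl

/-- The position of the ancestor. [cite: Balaban1983Higgs3, p.427] -/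
@[simp] theorem anc_z (s' : ℕ) (A : Cube d) (μ : Fin d) : (anc L s' A).z μ = A.z μ / L ^ (s' - A.s) := rfl

/-- A cube is its own ancestor at its own scale. [cite: Balaban1983Higgs3, p.427] -/
theorem anc_self (A : Cube d) : anc L A.s A = A := by
  ext μ <;> simp [anc]

/-- The ancestor's box starts no later. [cite: Balaban1983Higgs3, p.427] -/
theorem lo_anc_le {s' : ℕ} {A : Cube d} (h : A.s ≤ s') (μ : Fin d) : (anc L s' A).lo L μ ≤ A.lo L μ := by
  unfold lo
  simp only [anc_s, anc_z]
  have hsplit : L ^ s' = L ^ A.s * L ^ (s' - A.s) := by rw [← pow_add, Nat.add_sub_cancel' h]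
  rw [hsplit, mul_assoc]
  exact Nat.mul_le_mul_left _ (Nat.mul_div_le _ _)

/-- The ancestor's box ends no earlier (`L ≥ 1`). [cite: Balaban1983Higgs3, p.427] -/
theorem hi_le_hi_anc (hL : 0 < L) {s' : ℕ} {A : Cube d} (h : A.s ≤ s') (μ : Fin d) :
    A.hi L μ ≤ (anc L s' A).hi L μ := by
  unfold hi
  simp only [anc_s, anc_z]
  have hsplit : L ^ s' = L ^ A.s * L ^ (s' - A.s) := by rw [← pow_add, Nat.add_sub_cancel' h]
  rw [hsplit, mul_assoc]
  refine Nat.mul_le_mul_left _ ?_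
  have hq : 0 < L ^ (s' - A.s) := pow_pos hL _
  exact Nat.succ_le_of_lt (Nat.lt_mul_div_succ (A.z μ) hq)

/-- Coordinatewise monotonicity of the gap under enlarging the first cube. [cite: Balaban1983Higgs3, p.427] -/
theorem gap_anc_le (hL : 0 < L) {s' : ℕ} {A : Cube d} (h : A.s ≤ s') (B : Cube d) (μ : Fin d) :
    gap L (anc L s' A) B μ ≤ gap L A B μ := by
  have h1 := lo_anc_le (L := L) h μ
  have h2 := hi_le_hi_anc hL h μ
  unfold gap
  generalize (anc L s' A).lo L μ = a₁ at *
  generalize (anc L s' A).hi L μ = a₁' at *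
  generalize A.lo L μ = a at *
  generalize A.hi L μ = a' at *
  generalize B.lo L μ = b at *
  generalize B.hi L μ = b' at *
  omega

/-- p. 427 (used when *"we sum over Δ(v) ⊂ Δ(v₁)"* and the lines at v are re-attached to the coarser cube Δ(v₁)):
enlarging a cube can only decrease its distance to another cube, `dist(anc A, B) ≤ dist(A, B)`.
[cite: Balaban1983Higgs3, p.427] -/
theorem distI_anc_le (hL : 0 < L) {s' : ℕ} {A : Cube d} (h : A.s ≤ s') (B : Cube d) :
    distI L (anc L s' A) B ≤ distI L A B :=
  Finset.sup_mono_fun fun μ _ => gap_anc_le hL h B μ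

/-- The same in the second argument. [cite: Balaban1983Higgs3, p.427] -/
theorem distI_anc_le_right (hL : 0 < L) {s' : ℕ} {B : Cube d} (h : B.s ≤ s') (A : Cube d) :
    distI L A (anc L s' B) ≤ distI L A B := by
  rw [distI_comm, distI_comm A B]; exact distI_anc_le hL h A

/-- Ancestors compose: the scale-`s'` ancestor of the scale-`t'` ancestor is the scale-`s'` ancestor.
[cite: Balaban1983Higgs3, p.428] -/
theorem anc_anc {t' s' : ℕ} {A : Cube d} (h1 : A.s ≤ t') (h2 : t' ≤ s') : anc L s' (anc L t' A) = anc L s' A := by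
  ext μ
  · rfl
  · simp only [anc_z, anc_s]
    rw [Nat.div_div_eq_div_mul, ← pow_add]
    congr 2
    omega

/-! ## (a) descendants: the finer cubes inside a given one, and their number -/

variable (L) in
/-- The cubes of scale `t` contained in `Ah` (for `t ≤ Ah.s`): positions in the box `Π_μ [ẑ_μ q, (ẑ_μ + 1) q)`,
`q = L^{ŝ − t}` — the index set of *"Σ over Δ(v) ⊂ Δ(v₁)"* p. 427. [cite: Balaban1983Higgs3, p.427] -/
def desc (Ah : Cube d) (t : ℕ) : Finset (Cube d) :=
  (Fintype.piFinset fun μ => Finset.Ico (Ah.z μ * L ^ (Ah.s - t)) ((Ah.z μ + 1) * L ^ (Ah.s - t))).image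
    fun z => ⟨t, z⟩

/-- Membership: a cube lies in `desc Ah t` iff it has scale `t` and position `z` with `z_μ div q = ẑ_μ`.
[cite: Balaban1983Higgs3, p.427] -/
theorem mem_desc_iff (hL : 0 < L) {Ah A : Cube d} {t : ℕ} :
    A ∈ desc L Ah t ↔ A.s = t ∧ ∀ μ, A.z μ / L ^ (Ah.s - t) = Ah.z μ := by
  have hq : 0 < L ^ (Ah.s - t) := pow_pos hL _
  constructor
  · intro h
    obtain ⟨z, hz, rfl⟩ := Finset.mem_image.1 h
    refine ⟨rfl, fun μ => ?_⟩
    have hμ := (Fintype.mem_piFinset.1 hz) μ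
    rw [Finset.mem_Ico] at hμ
    apply le_antisymm
    · exact Nat.lt_succ_iff.1 ((Nat.div_lt_iff_lt_mul hq).2 hμ.2)
    · exact (Nat.le_div_iff_mul_le hq).2 hμ.1
  · rintro ⟨hs, hz⟩
    refine Finset.mem_image.2 ⟨A.z, ?_, by cases A; simp_all⟩
    refine Fintype.mem_piFinset.2 fun μ => Finset.mem_Ico.2 ⟨?_, ?_⟩
    · exact (Nat.le_div_iff_mul_le hq).1 (hz μ).ge
    · exact (Nat.div_lt_iff_lt_mul hq).1 (Nat.lt_succ_iff.2 (hz μ).le)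

/-- Membership via the ancestor map (for `t ≤ ŝ`). [cite: Balaban1983Higgs3, p.427] -/
theorem mem_desc_iff_anc (hL : 0 < L) {Ah A : Cube d} {t : ℕ} :
    A ∈ desc L Ah t ↔ A.s = t ∧ anc L Ah.s A = Ah := by
  rw [mem_desc_iff hL]
  constructor
  · rintro ⟨hs, hz⟩
    refine ⟨hs, ?_⟩
    ext μ
    · rfl
    · simp only [anc_z, hs]; exact hz μ
  · rintro ⟨hs, hanc⟩
    refine ⟨hs, fun μ => ?_⟩
    have := congrArg (fun C : Cube d => C.z μ) hanc
    simpa [hs] using this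

/-- A cube is a descendant of each of its ancestors. [cite: Balaban1983Higgs3, p.427] -/
theorem mem_desc_anc (hL : 0 < L) (s' : ℕ) (A : Cube d) : A ∈ desc L (anc L s' A) A.s := by
  rw [mem_desc_iff_anc hL]
  exact ⟨rfl, rfl⟩

/-- The only scale-`ŝ` descendant of `Ah` is `Ah` itself. [cite: Balaban1983Higgs3, p.428] -/
theorem desc_self (hL : 0 < L) (Ah : Cube d) : desc L Ah Ah.s = {Ah} := by
  ext A
  rw [mem_desc_iff_anc hL, Finset.mem_singleton]
  constructor
  · rintro ⟨hs, hanc⟩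
    rw [← hanc, ← hs, anc_self]
  · rintro rfl
    exact ⟨rfl, anc_self _⟩

/-- p. 427: a cube of scale `ŝ` contains exactly `(L^{ŝ−t})^d` cubes of scale `t` — the count behind *"we sum over
Δ(v) ⊂ Δ(v₁) using the factor (L^{j(v)}η)^d"* (`|Δ(v₁)|/|Δ(v)| = (L^{j(v₁)}η/L^{j(v)}η)^d`). [cite: Balaban1983Higgs3, p.427] -/
theorem card_desc (Ah : Cube d) (t : ℕ) : (desc L Ah t).card = (L ^ (Ah.s - t)) ^ d := by
  unfold desc
  rw [Finset.card_image_of_injective _ (fun z z' h => by simpa using h), Fintype.card_piFinset]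
  simp only [Nat.card_Ico]
  have e : ∀ x : Fin d, (Ah.z x + 1) * L ^ (Ah.s - t) - Ah.z x * L ^ (Ah.s - t) = L ^ (Ah.s - t) := fun x => by
    rw [Nat.add_mul, one_mul, Nat.add_sub_cancel_left]
  simp only [e, Finset.prod_const, Finset.card_univ, Fintype.card_fin]

/-- The descendants at scale `t` are partitioned by the descendants at an intermediate scale `t'`.
[cite: Balaban1983Higgs3, p.428] -/
theorem desc_eq_biUnion (hL : 0 < L) {Ah : Cube d} {t t' : ℕ} (ht : t ≤ t') (ht' : t' ≤ Ah.s) :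
    desc L Ah t = (desc L Ah t').biUnion fun A' => desc L A' t := by
  ext A
  rw [mem_desc_iff_anc hL, Finset.mem_biUnion]
  constructor
  · rintro ⟨hs, hanc⟩
    refine ⟨anc L t' A, (mem_desc_iff_anc hL).2 ⟨rfl, ?_⟩, ?_⟩
    · rw [anc_anc (by omega) ht']; exact hanc
    · rw [mem_desc_iff_anc hL]
      exact ⟨hs, rfl⟩
  · rintro ⟨A', hA', hA⟩
    obtain ⟨hs', hanc'⟩ := (mem_desc_iff_anc hL).1 hA'
    obtain ⟨hs, hanc⟩ := (mem_desc_iff_anc hL).1 hA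
    refine ⟨hs, ?_⟩
    have e : anc L Ah.s A = anc L Ah.s (anc L A'.s A) := by rw [anc_anc (by omega) (by omega)]
    rw [e, hanc, hanc']

/-- p. 428 (the inductive step (2.16), localizations of `G/G_i`): summing a function of the scale-`t'` ancestor over the
scale-`t` cubes inside `Ah` counts each scale-`t'` cube `(L^{t'−t})^d` times. [cite: Balaban1983Higgs3, (2.16) p.428] -/
theorem sum_desc_anc (hL : 0 < L) {M : Type*} [AddCommMonoid M] {Ah : Cube d} {t t' : ℕ} (ht : t ≤ t')
    (ht' : t' ≤ Ah.s) (F : Cube d → M) :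
    ∑ A ∈ desc L Ah t, F (anc L t' A) = ∑ A' ∈ desc L Ah t', (L ^ (t' - t)) ^ d • F A' := by
  rw [desc_eq_biUnion hL ht ht', Finset.sum_biUnion]
  · refine Finset.sum_congr rfl fun A' hA' => ?_
    obtain ⟨hs', -⟩ := (mem_desc_iff_anc hL).1 hA'
    have hconst : ∀ A ∈ desc L A' t, F (anc L t' A) = F A' := by
      intro A hA
      obtain ⟨-, hanc⟩ := (mem_desc_iff_anc hL).1 hA
      rw [← hanc, hs']
    rw [Finset.sum_congr rfl hconst, Finset.sum_const, card_desc, hs']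
  · intro A₁ h₁ A₂ h₂ hne
    simp only [Function.onFun]
    rw [Finset.disjoint_left]
    intro A hA1 hA2
    obtain ⟨hs1, -⟩ := (mem_desc_iff_anc hL).1 h₁
    obtain ⟨hs2, -⟩ := (mem_desc_iff_anc hL).1 h₂
    obtain ⟨-, e1⟩ := (mem_desc_iff_anc hL).1 hA1
    obtain ⟨-, e2⟩ := (mem_desc_iff_anc hL).1 hA2
    rw [hs1] at e1
    rw [hs2] at e2
    exact hne (e1.symm.trans e2)

/-- Every descendant has the prescribed scale. [cite: Balaban1983Higgs3, p.427] -/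
theorem s_of_mem_desc (hL : 0 < L) {Ah A : Cube d} {t : ℕ} (h : A ∈ desc L Ah t) : A.s = t :=
  ((mem_desc_iff hL).1 h).1

end Cube

end Literature.MathematicalPhysics.QuantumFieldTheory.Balaban1983to89.B3Ineq215
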